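import Mathlib.Algebra.CharP.Lemmas
import Mathlib.Logic.Function.Iterate
import Mathlib.Tactic.LinearCombination
import Mathlib.Tactic.Ring

/-!
# SoloBlind — the conormal lemma for a wild automorphism along a pointwise-fixed divisor

Solo line `solo-ResolutionOfSingularities-blind`, session 5 (paper §11.1, Lemma 11.1(i)).

Let `B` be a commutative ring of characteristic `p`, `σ` a ring endomorphism with `σ^p = id`, and `u ∈ B`
a non-zero-divisor such that `B/uB` has no non-zero `p`-nilpotents (e.g. `B/uB` reduced).  If `σ` is the
identity modulo `u` — geometrically: the divisor `E = {u = 0}` of the regular scheme `Spec B` is POINTWISE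
FIXED by the order-`p` automorphism `σ` — then `σ(u) ≡ u (mod u²)`, i.e. `σ` acts trivially on the conormal
bundle `uB/u²B` of `E`.  Proof: `σ(u) = u(1+c)`, hence `σ^j(u) ≡ u(1+c)^j (mod u²)`; at `j = p` this gives
`(1+c)^p - 1 = c^p ∈ uB`, so `c ∈ uB`.

Consequence used in the paper: writing the fixed ideal as `u^m · J`, the operator `D̃ = u^{-m}(σ - 1)` is
LOGARITHMIC along `E` when `m = 1` (`D̃(u) ∈ uB`), so that `D̃ mod u` is a derivation of `B/uB` — the residual
vector field of `σ` along `E`, whose zeros are exactly the fixed points that are not pseudo-reflection points.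

* `SoloBlind.iterate_gen_mod_sq` : `σ^[j] u = u (1+c)^j + u² r_j`;
* `SoloBlind.sigma_gen_mod_sq`   : the lemma, `∃ d, σ u = u + u² d`.
-/

namespace Summit.ResolutionOfSingularities.ResolutionOfSingularities.Theorems

/-- Iterates of an endomorphism that is the identity modulo `u`, evaluated on `u`, modulo `u²`. -/
theorem SoloBlind.iterate_gen_mod_sq {B : Type*} [CommRing B] (σ : B →+* B) (u c : B)
    (hu : σ u = u * (1 + c)) (hfix : ∀ b : B, ∃ d : B, σ b = b + u * d) (j : ℕ) :
    ∃ r : B, σ^[j] u = u * (1 + c) ^ j + u * u * r := by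
  induction j with
  | zero => exact ⟨0, by simp⟩
  | succ j ih =>
    obtain ⟨r, hr⟩ := ih
    obtain ⟨d, hd⟩ := hfix ((1 + c) ^ j)
    obtain ⟨d', hd'⟩ := hfix r
    refine ⟨(1 + c) * d + (1 + c) ^ 2 * (r + u * d'), ?_⟩
    rw [Function.iterate_succ_apply', hr]
    simp only [map_add, map_mul, hu, hd, hd']
    ring

/-- **Conormal lemma.** In characteristic `p`: if `σ^p = id`, `σ ≡ id (mod u)`, `u` is a non-zero-divisor
and `c^p ∈ uB ⇒ c ∈ uB`, then `σ u ≡ u (mod u²)`. -/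
theorem SoloBlind.sigma_gen_mod_sq {B : Type*} [CommRing B] (p : ℕ) [hp : Fact p.Prime] [CharP B p]
    (σ : B →+* B) (hσ : ∀ b : B, σ^[p] b = b) (u : B)
    (hfix : ∀ b : B, ∃ d : B, σ b = b + u * d)
    (hnzd : ∀ b : B, u * b = 0 → b = 0)
    (hred : ∀ c : B, (∃ d : B, c ^ p = u * d) → ∃ d : B, c = u * d) :
    ∃ d : B, σ u = u + u ^ 2 * d := by
  obtain ⟨c, hc⟩ := hfix u
  have hu : σ u = u * (1 + c) := by rw [hc]; ring
  obtain ⟨r, hr⟩ := SoloBlind.iterate_gen_mod_sq σ u c hu hfix p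
  rw [hσ] at hr
  have h1 : u * ((1 + c) ^ p - 1 + u * r) = 0 := by linear_combination (-1 : B) * hr
  have h2 : (1 + c) ^ p - 1 + u * r = 0 := hnzd _ h1
  have h3 : (1 + c) ^ p = 1 + c ^ p := by
    have H : (1 + c) ^ p = 1 ^ p + c ^ p := add_pow_char 1 c p
    rw [one_pow] at H
    exact H
  have h4 : c ^ p = u * (-r) := by linear_combination h2 - h3
  obtain ⟨d, hd⟩ := hred c ⟨-r, h4⟩
  exact ⟨d, by rw [hc, hd]; ring⟩

end Summit.ResolutionOfSingularities.ResolutionOfSingularities.Theorems
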